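import Literature.MathematicalPhysics.QuantumFieldTheory.Balaban1983to89.B8Eq138LandauZd

/-!
# `Balaban1983to89.B9Eq321LandauOrthogonalZd` — [Balaban1985BackgroundPropagators] (3.20)–(3.21) p. 394 with (3.23) p. 394, (3.19) p. 393 ∕
# [Balaban1985RegularSpaces] (1.38) p. 82 AT A CURVED BACKGROUND on the `ℤᵈ × 𝔸` carriers: the tree's MULTIPLIER FORM of the Landau gauge
# condition (`B8Eq138LandauZd.IsLandau138 … U₀ A`: «Δ^η_{U₀}(𝟙_{Ω₀}·D^{η*}_{U₀}A) = Q′(U₀)ᵀμ on Ω₀») IMPLIES print's ORTHOGONALITY FORM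
# «R(U₀)D^{η*}_{U₀}A = 0»: `D^{η*}_{U₀}A` is orthogonal to `Δ^η_{U₀}N(Q′(U₀))` — for EVERY background of units `U₀`, every Ad-invariant real
# pairing of the fibre, every finite `Ω₀` (the `U₀ = 1`, `𝔸 = ℂ` case is `B8Eq138LandauFlatOrthogonal`, seat dag-n05-c)

statement-level skeleton of published theorems with citation tags; proofs where landed; nothing here is a claim about the
Yang–Mills mass gap

`[Balaban1985BackgroundPropagators]` ("B9", CMP **99** (1985) 389–434) p. 394: *«R = R(U) is an orthogonal projection in the Hilbert space L²(Ω₀, g)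
onto the subspace R = Δ^η_U N(Q′), N(Q′) = {λ : Q′λ = 0}. (3.21)»*, *«Δ^η_U = D^{η*}_U D^η_U (3.23)»*, (3.19) p. 393 (the averaging `Q′_j(U)` with the
transporters `R(U(Γ))`), p. 391 *«The adjoints are taken with respect to natural L² scalar products … X·Y = tr XY»*; `[Balaban1985RegularSpaces]` ("B8",
CMP **99** (1985) 75–102) (1.1) p. 76 (the two covariant derivatives), (1.38) p. 82 *«R(U₀)D^{η*}_{U₀}A = 0»*, (1.42) p. 83.  PDF held:
`paper:balaban1985-cmp99-background-propagators` pp. 392–395 (re-read by this seat, 2026-08-27).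

CITATION HEADER (lean-in-tree rule).  Cell `pub-ymgap` (YM Track A, HUMAN RULING D-0062 ∕ D-0149 width push), DAG node N06 = [B9], width seat
`pub-ymgap-dag-n06-w4` (g0), plan g77 `W-SEAT-START-LIST` § n06 ITEM 4 «(γ) Thm 3.3 at a curved U₀ at the carrier — start with ONE binder (`LandauKills`)
at curved U₀».  WHY: the junction binders `B9SupplySockB9P3ZdLetters.LandauKills` ∕ `B9SupplySockB9P3ZdAt.LandauAt` (seat dag-n06-b) ask that, for a field
`A` obeying the Landau condition OF RECORD (the multiplier form `IsLandau138` of seat dag-n05-a — no scalar product needed to state it), the letter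
`D R(U₀) D* A` vanish.  Print's `R(U₀)` is the orthogonal projection onto `Δ^η_{U₀}N(Q′(U₀))` ((3.21)); so the CONTENT of the binder at a curved `U₀` is
«multiplier form ⇒ `D^{η*}_{U₀}A ⊥ Δ^η_{U₀}N(Q′(U₀))`».  The tree has it only at the flat background (`B8Eq138LandauFlatOrthogonal`, `U₀ = 1`, `𝔸 = ℂ`, real
stencils).  THIS FILE proves it for every background of units on the `ℤᵈ × 𝔸` carriers of the B8 lineage and every real pairing `B` of the fibre invariant
under the conjugations `R(u)` (`B7Eq78Linearization.conjR`) of a subgroup `S ≤ 𝔸ˣ` containing the bond variables `U₀(b)` and the block transporters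
`B8Eq119TwistedAxial.bgT L U₀ j y x` of (3.19): `S = ⊤` for the tracial pairing `(a, b) ↦ τ(ab)` of p. 391 (every background of UNITS, no unitarity);
`S =` the unitary units for pairings of the type `Re τ(a*b)`.

WHAT IS PROVED (kernel, 0 sorry; theorems only — no `def`, no `instance`, no `notation`).
* §1 (curved summation by parts, (1.1) + (3.23)) `finsum_pair_covDerivFwd` — `D^{η*}_{U₀,μ}` IS the `B`-transpose of `D^η_{U₀,μ}` on finitely supported
  functions: `Σᶠ_x B(g x, (D^η_μ f)(x)) = Σᶠ_x B((D^{η*}_μ g)(x), f x)`; `finsum_pair_covDerivFwd_left` (the flipped reading); `finsum_pair_covLap_eq_sum`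
  (`Σᶠ B(g, Δ^η_{U₀}f) = Σ_μ Σᶠ B(D^η_μ g, D^η_μ f)` — the quadratic form (3.23)); ★ `finsum_pair_covLap_symm` (`Δ^η_{U₀}` is `B`-symmetric — the curved
  twin of `B8Ineq159FlatShellModeCrossingDatum.finsum_mul_covLap_symm`).
* §2 (curved block transposes, (3.19)) `finsum_pair_qprimeT1` (one step: `B8Eq138LandauZd.qprimeT1` IS the `B`-transpose of the averaging step, in `finsum`
  form — n05-a's certificate `sum_pairing_Qprime_eq` is the `Finset` form for all units), ★ `finsum_pair_QprimeT` (the ITERATED transpose: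
  `Σᶠ_x B(g x, (Q′_jᵀν)(x)) = Σᶠ_y B((Q′_j(U₀)g)(y), ν y)` with `Q′_j(U₀) = B7Eq78Linearization.QprimeIter (zdBlocking d L) (bgT L U₀) j`),
  `finsum_pair_QT` (the level sum `QT`); supports: `support_covDerivFwd_finite`, `support_QprimeIter_finite`.
* §3 `finsum_pair_covLap_indicator_eq_zero_of_multiplier` (the core identity for a generic multiplier equation `Δ^η_{U₀}(𝟙_{Ω₀}φ) = Q′ᵀμ` on `Ω₀`);
  ★★ `finsum_pair_covLap_covDivB_eq_zero_of_isLandau138` — MULTIPLIER FORM ⇒ ORTHOGONALITY FORM at a curved background: `IsLandau138 L m η Ω₀ Λs U₀ A`,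
  `Ω₀` finite, `λ` supported in `Ω₀` with `Q′_j(U₀)λ = 0` on `Λs j` (`j ≤ m`; `j = 0` reads `λ = 0` on `Λ₀`) ⟹ `Σᶠ_x B((Δ^η_{U₀}λ)(x), (𝟙_{Ω₀}D^{η*}_{U₀}A)(x)) = 0`;
  ★ `finsum_pair_covLap_covDivB_sub_eq_zero_of_isLandau146` (the source form (1.146): `D^{η*}_{U₀}A − f ⊥_B Δ^η_{U₀}N(Q′(U₀))`);
  ★★ `sum_pair_eq_zero_of_inR138_of_isLandau138` — the same read on n05-a's «f from the space R(U₀)» (`B8Eq138LandauZd.InR138`): every `f ∈ Δ^η_{U₀}↾Ω₀N(Q′(U₀))`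
  is `B`-orthogonal to `D^{η*}_{U₀}A` over `Ω₀` — «R(U₀)D^{η*}_{U₀}A = 0» in print's Hilbert-space sense; ★ `…_units` corollaries (`S = ⊤`); ★
  `trace_mul_conjR` + `finsum_trace_covLap_mul_covDivB_eq_zero_of_isLandau138` (the tracial pairing `τ(ab)` of p. 391 qualifies for `S = ⊤`: the statement
  for every tracial `τ : 𝔸 →ₗ[ℂ] ℂ` and EVERY background of units).

HONEST SCOPE.  (i) Lattice bookkeeping at a curved background (summation by parts on `ℤᵈ` with transports; block transposes); NO estimate of [B9] ∕ [B8] is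
proved.  (ii) What the registered-shape binder `LandauAt` needs beyond this file: `R(U₀)` AS AN OPERATOR on `𝔸`-valued functions (a positive-definite
Ad-invariant pairing on `𝔤`-valued functions and UNITARY averaged transporters `Ū₀ʲ` — the tree keeps the latter as the hypothesis `hV` of
`B7Prop8PrintedConstants`), i.e. the genuine letter `DRDs := D R(U₀) D*`; NOT claimed here (located successor piece).  (iii) `finsum` junk: none used — every
`finsum` below has finite support by hypothesis.  (iv) Count-neutral; N05 ∕ N06 NOT discharged; K1⁷ `stmt-QuantumFields-20542` NOT closed; one finite `𝕋⁴`
programme at fixed `ε`, Bałaban as printed; R4 closes only the conditional finite-`𝕋⁴` rung `BalabanLadder.UV` — nothing continuum ∕ ℝ⁴ ∕ OS ∕ mass gap ∕ Clay.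
Unit `pub-ymgap-dag-n06-w4` (g0), 2026-08-27.
-/

noncomputable section

namespace Literature.MathematicalPhysics.QuantumFieldTheory.Balaban1983to89.B9Eq321LandauOrthogonalZd

open B7Prop1Explicit B7Eq78Linearization
open B8Ineq132 (covDeriv covDerivFwd)
open B8Eq119TwistedAxial (bgT)
open B8Eq138LandauZd (covDivB covLap qprimeT1 QprimeT QT IsLandau138 InR138)
open Literature.MathematicalPhysics.QuantumLattice (blockMap blockSites mem_blockSites_iff)

-- `Site` alone could resolve to the torus sites of `Setup.lean`; re-export the `ℤ^d` sites of `B7Prop1Explicit`.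
export B7Prop1Explicit (Site)

variable {d : ℕ}
variable {𝔸 : Type*} [NormedRing 𝔸] [NormedAlgebra ℂ 𝔸] [CompleteSpace 𝔸]
variable {V : Type*} [AddCommGroup V] [Module ℝ V]

/-! ## §0  Ad-invariant pairings: the two readings of the invariance, and `conjR` bookkeeping (private plumbing) -/

section Pairing

variable (B : 𝔸 →ₗ[ℝ] 𝔸 →ₗ[ℝ] V) (S : Subgroup 𝔸ˣ)

omit [NormedAlgebra ℂ 𝔸] [CompleteSpace 𝔸] in
/-- `R(u)0 = 0`. [folklore] -/
private theorem conjR_zero (u : 𝔸ˣ) : conjR u (0 : 𝔸) = 0 := by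
  simp [conjR]

omit [CompleteSpace 𝔸] in
/-- The second reading of the `Ad`-invariance of a pairing under a subgroup `S` of units: from `B(R(u)a, b) = B(a, R(u⁻¹)b)` for `u ∈ S` also
`B(a, R(u)b) = B(R(u⁻¹)a, b)` (apply the hypothesis to `u⁻¹ ∈ S`). [folklore] -/
private theorem pair_conjR_right (hB : ∀ u ∈ S, ∀ a b : 𝔸, B (conjR u a) b = B a (conjR u⁻¹ b)) {u : 𝔸ˣ} (hu : u ∈ S) (a b : 𝔸) :
    B a (conjR u b) = B (conjR u⁻¹ a) b := by
  have h := hB u⁻¹ (S.inv_mem hu) a b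
  rw [inv_inv] at h
  exact h.symm

omit [CompleteSpace 𝔸] in
/-- The flipped pairing `(a, b) ↦ B(b, a)` is `Ad`-invariant under `S` when `B` is. [folklore] -/
private theorem flip_invariant (hB : ∀ u ∈ S, ∀ a b : 𝔸, B (conjR u a) b = B a (conjR u⁻¹ b)) :
    ∀ u ∈ S, ∀ a b : 𝔸, B.flip (conjR u a) b = B.flip a (conjR u⁻¹ b) := by
  intro u hu a b
  rw [LinearMap.flip_apply, LinearMap.flip_apply]
  exact pair_conjR_right B S hB hu b a

omit [CompleteSpace 𝔸] in
/-- a pairing vanishes when its left argument does (bookkeeping). [folklore] -/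
private theorem pair_eq_zero_of_left {a : 𝔸} (ha : a = 0) (b : 𝔸) : B a b = 0 := by
  rw [ha, map_zero, LinearMap.zero_apply]

omit [CompleteSpace 𝔸] in
/-- a pairing vanishes when its right argument does (bookkeeping). [folklore] -/
private theorem pair_eq_zero_of_right (a : 𝔸) {b : 𝔸} (hb : b = 0) : B a b = 0 := by
  rw [hb, map_zero]

end Pairing

/-! ## §1  Curved summation by parts: `D^{η*}_{U₀}` is the transpose of `D^η_{U₀}`, and `Δ^η_{U₀}` is symmetric -/

section ByParts

variable (B : 𝔸 →ₗ[ℝ] 𝔸 →ₗ[ℝ] V) (S : Subgroup 𝔸ˣ)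
variable (η : ℝ) (U₀ : Site d → Fin d → 𝔸ˣ)

omit [CompleteSpace 𝔸] in
/-- Translation invariance of `finsum` on `ℤᵈ`: `Σᶠ_x F(x + t) = Σᶠ_x F(x)`. [folklore] -/
private theorem finsum_shift {M : Type*} [AddCommMonoid M] (t : Site d) (F : Site d → M) : ∑ᶠ x, F (x + t) = ∑ᶠ x, F x :=
  finsum_comp_equiv (Equiv.addRight t) (f := F)

omit [CompleteSpace 𝔸] in
/-- The support of `D^η_{U₀,μ}f` ((1.1)₁) lies in `supp f ∪ (supp f − e_μ)` — finite if `supp f` is. [cite: Balaban1985RegularSpaces, (1.1) p.76] -/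
theorem support_covDerivFwd_finite (μ : Fin d) {f : Site d → 𝔸} (hf : (Function.support f).Finite) :
    (Function.support (covDerivFwd η U₀ μ f)).Finite := by
  refine (hf.union (hf.image fun x => x - e μ)).subset fun x hx => ?_
  rw [Function.mem_support] at hx
  by_contra h
  simp only [Set.mem_union, Function.mem_support, Set.mem_image, not_or, not_not, not_exists, not_and] at h
  apply hx
  have h1 : f x = 0 := h.1
  have h2 : f (x + e μ) = 0 := by
    by_contra h2
    exact h.2 (x + e μ) h2 (by abel)
  simp [covDerivFwd, h1, h2, conjR]

omit [CompleteSpace 𝔸] in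
/-- ★ **`D^{η*}_{U₀,μ}` IS THE `B`-TRANSPOSE OF `D^η_{U₀,μ}`** (`g` finitely supported, `f` arbitrary), for every pairing `B` invariant under a subgroup
`S` of units containing the bond variables `U₀(x, x + e_μ)`: `Σᶠ_x B(g(x), (D^η_{U₀,μ}f)(x)) = Σᶠ_x B((D^{η*}_{U₀,μ}g)(x), f(x))` — (1.1):
`(D^η_{U,μ}f)(x) = η⁻¹(R(U(x,x+ηe_μ))f(x+ηe_μ) − f(x))`, `(D^{η*}_{U,μ}g)(x) = η⁻¹(R(U(x,x−ηe_μ))g(x−ηe_μ) − g(x))` with `U(x, x−e_μ) = U(x−e_μ, x)⁻¹`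
(translation of the lattice sum + `B(a, R(u)b) = B(R(u⁻¹)a, b)`). [cite: Balaban1985RegularSpaces, (1.1) p.76; Balaban1985BackgroundPropagators, (3.23) p.394, p.391 (the adjoints)] -/
theorem finsum_pair_covDerivFwd (hB : ∀ u ∈ S, ∀ a b : 𝔸, B (conjR u a) b = B a (conjR u⁻¹ b)) (μ : Fin d)
    (hU : ∀ x : Site d, U₀ x μ ∈ S) {f g : Site d → 𝔸} (hg : (Function.support g).Finite) :
    ∑ᶠ x, B (g x) (covDerivFwd η U₀ μ f x) = ∑ᶠ x, B (covDeriv η U₀ μ g x) (f x) := by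
  -- the two model summands
  set P : Site d → V := fun y => B (conjR (U₀ (y - e μ) μ)⁻¹ (η⁻¹ • g (y - e μ))) (f y) with hP
  set Q : Site d → V := fun y => B (η⁻¹ • g y) (f y) with hQ
  have hsm : ∀ a b : 𝔸, B a (η⁻¹ • b) = B (η⁻¹ • a) b := fun a b => by
    rw [map_smul, LinearMap.map_smul₂]
  have hL : ∀ x, B (g x) (covDerivFwd η U₀ μ f x) = P (x + e μ) - Q x := by
    intro x
    have h1 : B (g x) (η⁻¹ • conjR (U₀ x μ) (f (x + e μ))) = B (conjR (U₀ x μ)⁻¹ (η⁻¹ • g x)) (f (x + e μ)) := by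
      rw [← conjR_smul_real, pair_conjR_right B S hB (hU x), hsm, conjR_smul_real]
    simp only [hP, hQ, covDerivFwd, smul_sub, map_sub, add_sub_cancel_right, h1, hsm]
  have hR : ∀ y, B (covDeriv η U₀ μ g y) (f y) = P y - Q y := by
    intro y
    simp only [hP, hQ, covDeriv, smul_sub, map_sub, LinearMap.sub_apply, conjR_smul_real]
  have hPs : (Function.support P).Finite := by
    refine (hg.image fun x => x + e μ).subset fun y hy => ?_
    rw [Function.mem_support] at hy
    refine ⟨y - e μ, ?_, by abel⟩
    rw [Function.mem_support]
    intro h0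
    apply hy
    simp only [hP, h0, smul_zero, conjR_zero, map_zero, LinearMap.zero_apply]
  have hPs' : (Function.support fun x => P (x + e μ)).Finite := by
    refine (hg.subset fun x hx => ?_)
    rw [Function.mem_support] at hx ⊢
    intro h0
    apply hx
    simp only [hP, add_sub_cancel_right, h0, smul_zero, conjR_zero, map_zero, LinearMap.zero_apply]
  have hQs : (Function.support Q).Finite := by
    refine hg.subset fun x hx => ?_
    rw [Function.mem_support] at hx ⊢
    intro h0
    apply hx
    simp only [hQ, h0, smul_zero, map_zero, LinearMap.zero_apply]
  rw [finsum_congr hL, finsum_congr hR, finsum_sub_distrib hPs' hQs, finsum_sub_distrib hPs hQs, finsum_shift (e μ) P]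

omit [CompleteSpace 𝔸] in
/-- The flipped reading: `Σᶠ_x B((D^η_{U₀,μ}f)(x), g(x)) = Σᶠ_x B(f(x), (D^{η*}_{U₀,μ}g)(x))`. [cite: Balaban1985RegularSpaces, (1.1) p.76] -/
theorem finsum_pair_covDerivFwd_left (hB : ∀ u ∈ S, ∀ a b : 𝔸, B (conjR u a) b = B a (conjR u⁻¹ b)) (μ : Fin d)
    (hU : ∀ x : Site d, U₀ x μ ∈ S) {f g : Site d → 𝔸} (hg : (Function.support g).Finite) :
    ∑ᶠ x, B (covDerivFwd η U₀ μ f x) (g x) = ∑ᶠ x, B (f x) (covDeriv η U₀ μ g x) := by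
  have h := finsum_pair_covDerivFwd B.flip S η U₀ (flip_invariant B S hB) μ hU (f := f) hg
  simpa only [LinearMap.flip_apply] using h

omit [CompleteSpace 𝔸] in
/-- **The quadratic form of (3.23) at a curved background**: `Σᶠ_x B(g(x), (Δ^η_{U₀}f)(x)) = Σ_μ Σᶠ_x B((D^η_{U₀,μ}g)(x), (D^η_{U₀,μ}f)(x))`
(`Δ^η_U = D^{η*}_U D^η_U`). [cite: Balaban1985BackgroundPropagators, (3.23) p.394] -/
theorem finsum_pair_covLap_eq_sum (hB : ∀ u ∈ S, ∀ a b : 𝔸, B (conjR u a) b = B a (conjR u⁻¹ b))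
    (hU : ∀ (x : Site d) (μ : Fin d), U₀ x μ ∈ S) {f g : Site d → 𝔸} (hf : (Function.support f).Finite) (hg : (Function.support g).Finite) :
    ∑ᶠ x, B (g x) (covLap η U₀ f x) = ∑ μ : Fin d, ∑ᶠ x, B (covDerivFwd η U₀ μ g x) (covDerivFwd η U₀ μ f x) := by
  have h1 : ∀ x, B (g x) (covLap η U₀ f x) = ∑ μ : Fin d, B (g x) (covDeriv η U₀ μ (covDerivFwd η U₀ μ f) x) := by
    intro x
    simp only [covLap, covDivB, map_sum]
  rw [finsum_congr h1, finsum_sum_comm]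
  · refine Finset.sum_congr rfl fun μ _ => ?_
    exact (finsum_pair_covDerivFwd_left B S η U₀ hB μ (fun x => hU x μ) (support_covDerivFwd_finite η U₀ μ hf)).symm
  · intro μ _
    refine hg.subset fun x hx => ?_
    rw [Function.mem_support] at hx ⊢
    intro h0
    exact hx (pair_eq_zero_of_left B h0 _)

omit [CompleteSpace 𝔸] in
/-- ★ **`Δ^η_{U₀}` IS `B`-SYMMETRIC on finitely supported functions of `ℤᵈ`** for every background whose bond variables lie in `S`:
`Σᶠ_x B(g(x), (Δ^η_{U₀}f)(x)) = Σᶠ_x B((Δ^η_{U₀}g)(x), f(x))` — the pairing by which (3.20)–(3.21) ∕ (1.38) read «R D* A = 0» (curved twin of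
`B8Ineq159FlatShellModeCrossingDatum.finsum_mul_covLap_symm`). [cite: Balaban1985BackgroundPropagators, (3.23) p.394, (3.20)–(3.21) p.394; Balaban1984PropagatorsII, (2.11)–(2.12) p.225] -/
theorem finsum_pair_covLap_symm (hB : ∀ u ∈ S, ∀ a b : 𝔸, B (conjR u a) b = B a (conjR u⁻¹ b))
    (hU : ∀ (x : Site d) (μ : Fin d), U₀ x μ ∈ S) {f g : Site d → 𝔸} (hf : (Function.support f).Finite) (hg : (Function.support g).Finite) :
    ∑ᶠ x, B (g x) (covLap η U₀ f x) = ∑ᶠ x, B (covLap η U₀ g x) (f x) := by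
  rw [finsum_pair_covLap_eq_sum B S η U₀ hB hU hf hg]
  have h := finsum_pair_covLap_eq_sum B.flip S η U₀ (flip_invariant B S hB) hU hg hf
  simp only [LinearMap.flip_apply] at h
  rw [h]

end ByParts

/-! ## §2  Curved block transposes: `Q′_j(U₀)ᵀ` (`qprimeT1` ∕ `QprimeT` ∕ `QT`) against `Q′_j(U₀)` (`QprimeIter (zdBlocking d L) (bgT L U₀) j`) -/

section Transposes

variable (B : 𝔸 →ₗ[ℝ] 𝔸 →ₗ[ℝ] V) (S : Subgroup 𝔸ˣ)
variable (L : ℕ) [NeZero L] (U₀ : Site d → Fin d → 𝔸ˣ)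

/-- The support of `Q′_j(U₀)g` lies in the `Lʲ`-block image of the support of `g` — finite if that is (induction on the (3.19) recursion).
[cite: Balaban1985BackgroundPropagators, (3.19) p.393] -/
theorem support_QprimeIter_finite {g : Site d → 𝔸} (hg : (Function.support g).Finite) :
    ∀ j : ℕ, (Function.support (QprimeIter (zdBlocking d L) (bgT L U₀) j g)).Finite := by
  intro j
  induction j with
  | zero => simpa [QprimeIter] using hg
  | succ j ih =>
    refine (ih.image (blockMap L)).subset fun z hz => ?_
    rw [Function.mem_support] at hz
    by_contra hz'
    apply hz
    show Qprime ((zdBlocking d L).B j z) ((zdBlocking d L).wt j z) (bgT L U₀ j z) (QprimeIter (zdBlocking d L) (bgT L U₀) j g) = 0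
    refine Finset.sum_eq_zero fun y hy => ?_
    have hyz : blockMap L y = z := (mem_blockSites_iff L z y).1 hy
    have h0 : QprimeIter (zdBlocking d L) (bgT L U₀) j g y = 0 := by
      by_contra h0
      exact hz' ⟨y, Function.mem_support.2 h0, hyz⟩
    rw [h0, conjR_zero, smul_zero]

/-- **ONE STEP: `qprimeT1` IS THE `B`-TRANSPOSE OF THE AVERAGING STEP (3.19)** in `finsum` form, for a pairing invariant under a subgroup `S` of units
containing the block transporters `T_j(z, y) = Ū₀ʲ(Γ_{z,y})`: `Σᶠ_y B(g(y), (Q′ᵀν)(y)) = Σᶠ_z B((Q′g)(z), ν(z))`, `g` finitely supported, `ν` arbitrary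
(n05-a's `sum_pairing_Qprime_eq` is the `Finset` form). [cite: Balaban1985BackgroundPropagators, (3.19) p.393; Balaban1985RegularSpaces, (1.29) p.81] -/
theorem finsum_pair_qprimeT1 (hB : ∀ u ∈ S, ∀ a b : 𝔸, B (conjR u a) b = B a (conjR u⁻¹ b)) (j : ℕ)
    (hT : ∀ z y : Site d, bgT L U₀ j z y ∈ S) {g : Site d → 𝔸} (hg : (Function.support g).Finite) (ν : Site d → 𝔸) :
    ∑ᶠ y, B (g y) (qprimeT1 L U₀ j ν y) =
      ∑ᶠ z, B (Qprime ((zdBlocking d L).B j z) ((zdBlocking d L).wt j z) (bgT L U₀ j z) g) (ν z) := by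
  classical
  set t : Finset (Site d) := hg.toFinset.image (blockMap L) with ht
  -- disjointness of the blocks
  have hdisj : (t : Set (Site d)).PairwiseDisjoint (blockSites L) := by
    intro y _ y' _ hne
    refine Finset.disjoint_left.mpr fun x hx hx' => hne ?_
    rw [mem_blockSites_iff] at hx hx'
    rw [← hx, ← hx']
  -- the left side as a finite sum over the blocks of `t`
  have hLsupp : (Function.support fun y => B (g y) (qprimeT1 L U₀ j ν y)) ⊆ ↑(t.biUnion (blockSites L)) := by
    intro y hy
    rw [Function.mem_support] at hy
    rw [Finset.coe_biUnion, Set.mem_iUnion₂]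
    refine ⟨blockMap L y, ?_, (mem_blockSites_iff L _ y).2 rfl⟩
    rw [ht, Finset.coe_image]
    refine ⟨y, ?_, rfl⟩
    rw [Set.Finite.coe_toFinset, Function.mem_support]
    intro h0
    exact hy (pair_eq_zero_of_left B h0 _)
  have hRsupp : (Function.support fun z =>
      B (Qprime ((zdBlocking d L).B j z) ((zdBlocking d L).wt j z) (bgT L U₀ j z) g) (ν z)) ⊆ ↑t := by
    intro z hz
    rw [Function.mem_support] at hz
    by_contra hzt
    apply hz
    refine pair_eq_zero_of_left B (Finset.sum_eq_zero fun y hy => ?_) _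
    have hyz : blockMap L y = z := (mem_blockSites_iff L z y).1 hy
    have h0 : g y = 0 := by
      by_contra h0
      apply hzt
      rw [ht, Finset.mem_coe, Finset.mem_image]
      exact ⟨y, by rw [Set.Finite.mem_toFinset, Function.mem_support]; exact h0, hyz⟩
    rw [h0, conjR_zero, smul_zero]
  rw [finsum_eq_sum_of_support_subset _ hLsupp, finsum_eq_sum_of_support_subset _ hRsupp, Finset.sum_biUnion hdisj]
  refine Finset.sum_congr rfl fun z _ => ?_
  show ∑ y ∈ blockSites L z, B (g y) (qprimeT1 L U₀ j ν y) =
    B (∑ y ∈ blockSites L z, ((L : ℝ) ^ d)⁻¹ • conjR (bgT L U₀ j z y) (g y)) (ν z)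
  rw [map_sum, LinearMap.sum_apply]
  refine Finset.sum_congr rfl fun y hy => ?_
  have hyz : blockMap L y = z := (mem_blockSites_iff L z y).1 hy
  rw [qprimeT1, hyz, map_smul, LinearMap.map_smul₂, pair_conjR_right B S hB (S.inv_mem (hT z y)), inv_inv]

/-- ★ **THE ITERATED TRANSPOSE: `QprimeT L U₀ j` IS THE `B`-TRANSPOSE OF `Q′_j(U₀)`** = `QprimeIter (zdBlocking d L) (bgT L U₀) j` ((3.19):
`Q′_j(U) = Q′(Ūʲ⁻¹)⋯Q′(U)`; the transposes composed in reverse order): `Σᶠ_x B(g(x), (Q′_jᵀν)(x)) = Σᶠ_y B((Q′_j(U₀)g)(y), ν(y))` for `g` finitely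
supported and every `ν`. [cite: Balaban1985BackgroundPropagators, (3.19) p.393; Balaban1985RegularSpaces, (1.29) p.81] -/
theorem finsum_pair_QprimeT (hB : ∀ u ∈ S, ∀ a b : 𝔸, B (conjR u a) b = B a (conjR u⁻¹ b))
    (hT : ∀ (j : ℕ) (z y : Site d), bgT L U₀ j z y ∈ S) {g : Site d → 𝔸} (hg : (Function.support g).Finite) :
    ∀ (j : ℕ) (ν : Site d → 𝔸),
      ∑ᶠ x, B (g x) (QprimeT L U₀ j ν x) = ∑ᶠ y, B (QprimeIter (zdBlocking d L) (bgT L U₀) j g y) (ν y) := by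
  intro j
  induction j with
  | zero => intro ν; rfl
  | succ j ih =>
    intro ν
    show ∑ᶠ x, B (g x) (QprimeT L U₀ j (qprimeT1 L U₀ j ν) x) = _
    rw [ih (qprimeT1 L U₀ j ν), finsum_pair_qprimeT1 B S L U₀ hB j (hT j) (support_QprimeIter_finite L U₀ hg j) ν]
    rfl

/-- **The level sum**: `Σᶠ_x B(g(x), (Q′(U₀)ᵀμ)(x)) = Σ_{j ≤ m} Σᶠ_y B((Q′_j(U₀)g)(y), 𝟙_{Λ_j}(y)μ_j(y))` for the multiplier transpose `QT L m Λs U₀ μ`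
of (1.38)'s record form ((3.24): the levels `j = 0, …, m` summed against the constraint sets `Λ_j`). [cite: Balaban1985BackgroundPropagators, (3.24) p.394, (3.19) p.393] -/
theorem finsum_pair_QT (hB : ∀ u ∈ S, ∀ a b : 𝔸, B (conjR u a) b = B a (conjR u⁻¹ b))
    (hT : ∀ (j : ℕ) (z y : Site d), bgT L U₀ j z y ∈ S) {g : Site d → 𝔸} (hg : (Function.support g).Finite)
    (m : ℕ) (Λs : ℕ → Set (Site d)) (μ : ℕ → Site d → 𝔸) :
    ∑ᶠ x, B (g x) (QT L m Λs U₀ μ x) =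
      ∑ j ∈ Finset.range (m + 1), ∑ᶠ y, B (QprimeIter (zdBlocking d L) (bgT L U₀) j g y) ((Λs j).indicator (μ j) y) := by
  have h1 : ∀ x, B (g x) (QT L m Λs U₀ μ x) = ∑ j ∈ Finset.range (m + 1), B (g x) (QprimeT L U₀ j ((Λs j).indicator (μ j)) x) := by
    intro x
    simp only [QT, map_sum]
  rw [finsum_congr h1, finsum_sum_comm]
  · exact Finset.sum_congr rfl fun j _ => finsum_pair_QprimeT B S L U₀ hB hT hg j _
  · intro j _
    refine hg.subset fun x hx => ?_
    rw [Function.mem_support] at hx ⊢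
    intro h0
    exact hx (pair_eq_zero_of_left B h0 _)

end Transposes

/-! ## §3  Multiplier form ⇒ orthogonality form of the Landau condition at a curved background -/

section Landau

variable (B : 𝔸 →ₗ[ℝ] 𝔸 →ₗ[ℝ] V) (S : Subgroup 𝔸ˣ)
variable {L m : ℕ} [NeZero L] {η : ℝ} {Ω₀ : Set (Site d)} {Λs : ℕ → Set (Site d)} {U₀ : Site d → Fin d → 𝔸ˣ}

/-- **THE CORE IDENTITY (generic multiplier equation).**  Let `B` be a real pairing of the fibre invariant under a subgroup `S` of units containing the
bond variables `U₀(b)` and the block transporters `Ū₀ʲ(Γ_{z,y})` (`bgT`), `Ω₀` finite.  If a site function `φ` satisfies the multiplier equation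
`Δ^η_{U₀}(𝟙_{Ω₀}φ) = Q′(U₀)ᵀμ` on `Ω₀` (the common shape of (1.38) with `φ = D^{η*}_{U₀}A` and of (1.146) with `φ = D^{η*}_{U₀}A − f`), then for every gauge
function `λ` of `N(Q′(U₀))` — supported in `Ω₀`, `(Q′_j(U₀)λ)(y) = 0` for `y ∈ Λs j`, `j ≤ m` — `Σᶠ_x B((Δ^η_{U₀}λ)(x), (𝟙_{Ω₀}φ)(x)) = 0`.  Proof: move
`Δ^η_{U₀}` across (§1), insert the multiplier equation on `Ω₀`, transpose `Q′ᵀ` back onto `λ` (§2), and use `Q′_jλ = 0` on `Λ_j`.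
[cite: Balaban1985RegularSpaces, (1.38) p.82, (1.146) p.101; Balaban1985BackgroundPropagators, (3.20)–(3.21) p.394, (3.23)–(3.24) p.394, (3.19) p.393] -/
theorem finsum_pair_covLap_indicator_eq_zero_of_multiplier (hB : ∀ u ∈ S, ∀ a b : 𝔸, B (conjR u a) b = B a (conjR u⁻¹ b))
    (hU : ∀ (x : Site d) (μ : Fin d), U₀ x μ ∈ S) (hT : ∀ (j : ℕ) (z y : Site d), bgT L U₀ j z y ∈ S) (hΩ : Ω₀.Finite)
    {φ : Site d → 𝔸} {μ : ℕ → Site d → 𝔸} (hμ : ∀ x ∈ Ω₀, covLap η U₀ (Ω₀.indicator φ) x = QT L m Λs U₀ μ x)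
    {lam : Site d → 𝔸} (hsupp : ∀ x, x ∉ Ω₀ → lam x = 0)
    (hQ : ∀ j, j ≤ m → ∀ y ∈ Λs j, QprimeIter (zdBlocking d L) (bgT L U₀) j lam y = 0) :
    ∑ᶠ x, B (covLap η U₀ lam x) (Ω₀.indicator φ x) = 0 := by
  have hlam : (Function.support lam).Finite := hΩ.subset fun x hx => by
    by_contra h'; exact hx (hsupp x h')
  have hφ : (Function.support (Ω₀.indicator φ)).Finite := hΩ.subset Set.support_indicator_subset
  -- move `Δ^η_{U₀}` to the other side
  rw [← finsum_pair_covLap_symm B S η U₀ hB hU hφ hlam]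
  -- insert the multiplier equation on `Ω₀` (off `Ω₀`, `λ = 0`)
  have h1 : ∀ x, B (lam x) (covLap η U₀ (Ω₀.indicator φ) x) = B (lam x) (QT L m Λs U₀ μ x) := by
    intro x
    by_cases hx : x ∈ Ω₀
    · rw [hμ x hx]
    · rw [hsupp x hx, map_zero, LinearMap.zero_apply, LinearMap.zero_apply]
  rw [finsum_congr h1, finsum_pair_QT B S L U₀ hB hT hlam m Λs μ]
  -- every level vanishes: `Q′_jλ = 0` on `Λ_j`, the multiplier is read on `Λ_j` only
  refine Finset.sum_eq_zero fun j hj => ?_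
  have hjm : j ≤ m := Nat.lt_succ_iff.1 (Finset.mem_range.1 hj)
  have h0 : ∀ y, B (QprimeIter (zdBlocking d L) (bgT L U₀) j lam y) ((Λs j).indicator (μ j) y) = 0 := by
    intro y
    by_cases hy : y ∈ Λs j
    · exact pair_eq_zero_of_left B (hQ j hjm y hy) _
    · exact pair_eq_zero_of_right B _ (Set.indicator_of_notMem hy _)
  rw [finsum_congr h0, finsum_zero]

/-- ★★ **MULTIPLIER FORM ⇒ ORTHOGONALITY FORM OF THE LANDAU CONDITION (1.38) AT A CURVED BACKGROUND.**  Let `B` be a real pairing of the fibre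
invariant under a subgroup `S` of units containing the bond variables `U₀(b)` and the block transporters `Ū₀ʲ(Γ_{z,y})` (`bgT`), `Ω₀` finite.  If
`Δ^η_{U₀}(𝟙_{Ω₀}·D^{η*}_{U₀}A) = Q′(U₀)ᵀμ` on `Ω₀` (`IsLandau138 L m η Ω₀ Λs U₀ A`), then for every gauge function `λ` of `N(Q′(U₀))` — supported in `Ω₀`,
with `(Q′_j(U₀)λ)(y) = 0` for `y ∈ Λs j`, `j ≤ m` (`j = 0`: `λ = 0` on `Λ₀`) — the pairing `Σᶠ_x B((Δ^η_{U₀}λ)(x), (𝟙_{Ω₀}D^{η*}_{U₀}A)(x))` vanishes: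
`D^{η*}_{U₀}A ⊥_B Δ^η_{U₀}N(Q′(U₀))`, i.e. «R(U₀)D^{η*}_{U₀}A = 0» for `R(U₀)` the orthogonal projection onto `Δ^η_{U₀}N(Q′(U₀))` ((3.21)).
[cite: Balaban1985RegularSpaces, (1.38) p.82, (1.42) p.83; Balaban1985BackgroundPropagators, (3.20)–(3.21) p.394, (3.23)–(3.24) p.394, (3.19) p.393] -/
theorem finsum_pair_covLap_covDivB_eq_zero_of_isLandau138 (hB : ∀ u ∈ S, ∀ a b : 𝔸, B (conjR u a) b = B a (conjR u⁻¹ b))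
    (hU : ∀ (x : Site d) (μ : Fin d), U₀ x μ ∈ S) (hT : ∀ (j : ℕ) (z y : Site d), bgT L U₀ j z y ∈ S) (hΩ : Ω₀.Finite)
    {A : Site d → Fin d → 𝔸} (h : IsLandau138 L m η Ω₀ Λs U₀ A)
    {lam : Site d → 𝔸} (hsupp : ∀ x, x ∉ Ω₀ → lam x = 0)
    (hQ : ∀ j, j ≤ m → ∀ y ∈ Λs j, QprimeIter (zdBlocking d L) (bgT L U₀) j lam y = 0) :
    ∑ᶠ x, B (covLap η U₀ lam x) (Ω₀.indicator (covDivB η U₀ A) x) = 0 := by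
  obtain ⟨μ, hμ⟩ := h
  exact finsum_pair_covLap_indicator_eq_zero_of_multiplier B S hB hU hT hΩ hμ hsupp hQ

/-- ★ **THE SOURCE FORM (1.146) «R(U₀)D^{η*}_{U₀}A = f»**: if `A` satisfies the multiplier form of (1.146) (`B8Eq138LandauZd.IsLandau146`:
`f ∈ R(U₀)` and `Δ^η_{U₀}↾Ω₀(D^{η*}_{U₀}A − f) = Q′(U₀)ᵀμ` on `Ω₀`), then `D^{η*}_{U₀}A − f ⊥_B Δ^η_{U₀}N(Q′(U₀))` — the orthogonal projection of
`D^{η*}_{U₀}A − f` onto `R(U₀)` vanishes, which with `R(U₀)f = f` is print's `R(U₀)D^{η*}_{U₀}A = f`. [cite: Balaban1985RegularSpaces, (1.146) p.101; Balaban1985BackgroundPropagators, (3.20)–(3.21) p.394] -/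
theorem finsum_pair_covLap_covDivB_sub_eq_zero_of_isLandau146 (hB : ∀ u ∈ S, ∀ a b : 𝔸, B (conjR u a) b = B a (conjR u⁻¹ b))
    (hU : ∀ (x : Site d) (μ : Fin d), U₀ x μ ∈ S) (hT : ∀ (j : ℕ) (z y : Site d), bgT L U₀ j z y ∈ S) (hΩ : Ω₀.Finite)
    {f : Site d → 𝔸} {A : Site d → Fin d → 𝔸} (h : B8Eq138LandauZd.IsLandau146 L m η Ω₀ Λs U₀ f A)
    {lam : Site d → 𝔸} (hsupp : ∀ x, x ∉ Ω₀ → lam x = 0)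
    (hQ : ∀ j, j ≤ m → ∀ y ∈ Λs j, QprimeIter (zdBlocking d L) (bgT L U₀) j lam y = 0) :
    ∑ᶠ x, B (covLap η U₀ lam x) (Ω₀.indicator (covDivB η U₀ A - f) x) = 0 := by
  obtain ⟨-, μ, hμ⟩ := h
  exact finsum_pair_covLap_indicator_eq_zero_of_multiplier B S hB hU hT hΩ hμ hsupp hQ

/-- ★★ **«R(U₀)D^{η*}_{U₀}A = 0» READ ON THE SPACE R(U₀) OF RECORD**: under the same invariance and finiteness hypotheses, if `A` satisfies the
multiplier form (1.38) then EVERY `f` «from the space R(U₀)» (`B8Eq138LandauZd.InR138`: `f = Δ^η_{U₀}↾Ω₀λ` on `Ω₀` with `Q′_j(U₀)λ = 0` on `Λ_j`, `j ≤ m`)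
is `B`-orthogonal to `D^{η*}_{U₀}A` over `Ω₀`: `Σ_{x ∈ Ω₀} B(f(x), (D^{η*}_{U₀}A)(x)) = 0` — the orthogonal projection of `D^{η*}_{U₀}A` onto
`R(U₀) = Δ^η_{U₀}N(Q′(U₀))` vanishes, print's (1.38) ∕ (3.20)–(3.21). [cite: Balaban1985RegularSpaces, (1.38) p.82, (1.146) p.101 («f from the space R(U₀)»); Balaban1985BackgroundPropagators, (3.20)–(3.21) p.394] -/
theorem sum_pair_eq_zero_of_inR138_of_isLandau138 (hB : ∀ u ∈ S, ∀ a b : 𝔸, B (conjR u a) b = B a (conjR u⁻¹ b))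
    (hU : ∀ (x : Site d) (μ : Fin d), U₀ x μ ∈ S) (hT : ∀ (j : ℕ) (z y : Site d), bgT L U₀ j z y ∈ S) (hΩ : Ω₀.Finite)
    {A : Site d → Fin d → 𝔸} (h : IsLandau138 L m η Ω₀ Λs U₀ A) {f : Site d → 𝔸} (hf : InR138 L m η Ω₀ Λs U₀ f) :
    ∑ x ∈ hΩ.toFinset, B (f x) (covDivB η U₀ A x) = 0 := by
  obtain ⟨lam, hQ, hfx⟩ := hf
  have hsupp : ∀ x, x ∉ Ω₀ → Ω₀.indicator lam x = 0 := fun x hx => Set.indicator_of_notMem hx _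
  have key := finsum_pair_covLap_covDivB_eq_zero_of_isLandau138 B S hB hU hT hΩ h hsupp hQ
  -- the `finsum` is the sum over `Ω₀`, where `Δ^η_{U₀}↾Ω₀λ = f`
  have hs : (Function.support fun x => B (covLap η U₀ (Ω₀.indicator lam) x) (Ω₀.indicator (covDivB η U₀ A) x)) ⊆ ↑hΩ.toFinset := by
    intro x hx
    rw [Function.mem_support] at hx
    rw [Set.Finite.coe_toFinset]
    by_contra hx'
    exact hx (pair_eq_zero_of_right B _ (Set.indicator_of_notMem hx' _))
  rw [finsum_eq_sum_of_support_subset _ hs] at key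
  rw [← key]
  refine Finset.sum_congr rfl fun x hx => ?_
  rw [Set.Finite.mem_toFinset] at hx
  rw [hfx x hx, Set.indicator_of_mem hx]

/-- ★ **COROLLARY — EVERY BACKGROUND OF UNITS** (`S = ⊤`): for a pairing invariant under ALL conjugations `R(u)`, `u ∈ 𝔸ˣ` (e.g. the tracial pairing
`τ(ab)` of p. 391 — `trace_mul_conjR` below), the orthogonality form holds at EVERY `U₀ : Site d → Fin d → 𝔸ˣ`, with no unitarity hypothesis on `U₀` or on
its averages. [cite: Balaban1985RegularSpaces, (1.38) p.82; Balaban1985BackgroundPropagators, (3.20)–(3.21) p.394] -/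
theorem finsum_pair_covLap_covDivB_eq_zero_of_isLandau138_units (hB : ∀ (u : 𝔸ˣ) (a b : 𝔸), B (conjR u a) b = B a (conjR u⁻¹ b))
    (hΩ : Ω₀.Finite) {A : Site d → Fin d → 𝔸} (h : IsLandau138 L m η Ω₀ Λs U₀ A)
    {lam : Site d → 𝔸} (hsupp : ∀ x, x ∉ Ω₀ → lam x = 0)
    (hQ : ∀ j, j ≤ m → ∀ y ∈ Λs j, QprimeIter (zdBlocking d L) (bgT L U₀) j lam y = 0) :
    ∑ᶠ x, B (covLap η U₀ lam x) (Ω₀.indicator (covDivB η U₀ A) x) = 0 :=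
  finsum_pair_covLap_covDivB_eq_zero_of_isLandau138 B ⊤ (fun u _ a b => hB u a b) (fun _ _ => Subgroup.mem_top _)
    (fun _ _ _ => Subgroup.mem_top _) hΩ h hsupp hQ

/-- ★ **COROLLARY — the space `R(U₀)` reading at every background of units** (`S = ⊤`). [cite: Balaban1985RegularSpaces, (1.38) p.82, (1.146) p.101; Balaban1985BackgroundPropagators, (3.20)–(3.21) p.394] -/
theorem sum_pair_eq_zero_of_inR138_of_isLandau138_units (hB : ∀ (u : 𝔸ˣ) (a b : 𝔸), B (conjR u a) b = B a (conjR u⁻¹ b))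
    (hΩ : Ω₀.Finite) {A : Site d → Fin d → 𝔸} (h : IsLandau138 L m η Ω₀ Λs U₀ A) {f : Site d → 𝔸} (hf : InR138 L m η Ω₀ Λs U₀ f) :
    ∑ x ∈ hΩ.toFinset, B (f x) (covDivB η U₀ A x) = 0 :=
  sum_pair_eq_zero_of_inR138_of_isLandau138 B ⊤ (fun u _ a b => hB u a b) (fun _ _ => Subgroup.mem_top _)
    (fun _ _ _ => Subgroup.mem_top _) hΩ h hf

end Landau

/-! ## §4  The tracial pairing of p. 391 qualifies (all units): the statement for `τ(ab)` at every background of units -/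

section Trace

variable {L m : ℕ} [NeZero L] {η : ℝ} {Ω₀ : Set (Site d)} {Λs : ℕ → Set (Site d)} {U₀ : Site d → Fin d → 𝔸ˣ}

omit [CompleteSpace 𝔸] in
/-- **THE TRACIAL PAIRING IS `Ad`-INVARIANT UNDER ALL UNITS**: for a linear functional `τ` with `τ(ab) = τ(ba)` (print's normalised trace `tr`, p. 391 «X·Y =
tr XY»), `τ(R(u)a · b) = τ(a · R(u⁻¹)b)` for EVERY unit `u` (cyclicity; no unitarity). [cite: Balaban1985BackgroundPropagators, p.391 (the scalar product), (3.17) p.393] -/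
theorem trace_mul_conjR (τ : 𝔸 →ₗ[ℂ] ℂ) (hτ : ∀ a b : 𝔸, τ (a * b) = τ (b * a)) (u : 𝔸ˣ) (a b : 𝔸) :
    τ (conjR u a * b) = τ (a * conjR u⁻¹ b) := by
  have h1 : conjR u a * b = (u : 𝔸) * (a * ((u⁻¹ : 𝔸ˣ) : 𝔸) * b) := by
    simp only [conjR, mul_assoc]
  have h2 : a * conjR u⁻¹ b = (a * ((u⁻¹ : 𝔸ˣ) : 𝔸) * b) * (u : 𝔸) := by
    simp only [conjR, inv_inv, mul_assoc]
  rw [h1, h2, hτ]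

/-- ★ **THE ORTHOGONALITY FORM FOR THE TRACIAL PAIRING AT EVERY BACKGROUND OF UNITS**: `τ` tracial, `Ω₀` finite, `IsLandau138 L m η Ω₀ Λs U₀ A`, `λ` supported in
`Ω₀` with `Q′_j(U₀)λ = 0` on `Λ_j` (`j ≤ m`) ⟹ `Σᶠ_x τ((Δ^η_{U₀}λ)(x)·(𝟙_{Ω₀}D^{η*}_{U₀}A)(x)) = 0` — «⟨Δ^η_{U₀}λ, D^{η*}_{U₀}A⟩ = 0» in print's pairing
`⟨λ, λ′⟩ = Σ_x η^d tr λ(x)λ′(x)` (the positive weight `η^d` dropped). [cite: Balaban1985RegularSpaces, (1.38) p.82; Balaban1985BackgroundPropagators, (3.17) p.393, (3.20)–(3.21) p.394] -/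
theorem finsum_trace_covLap_mul_covDivB_eq_zero_of_isLandau138 (τ : 𝔸 →ₗ[ℂ] ℂ) (hτ : ∀ a b : 𝔸, τ (a * b) = τ (b * a))
    (hΩ : Ω₀.Finite) {A : Site d → Fin d → 𝔸} (h : IsLandau138 L m η Ω₀ Λs U₀ A)
    {lam : Site d → 𝔸} (hsupp : ∀ x, x ∉ Ω₀ → lam x = 0)
    (hQ : ∀ j, j ≤ m → ∀ y ∈ Λs j, QprimeIter (zdBlocking d L) (bgT L U₀) j lam y = 0) :
    ∑ᶠ x, τ (covLap η U₀ lam x * Ω₀.indicator (covDivB η U₀ A) x) = 0 := by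
  have key := finsum_pair_covLap_covDivB_eq_zero_of_isLandau138_units ((LinearMap.mul ℝ 𝔸).compr₂ (τ.restrictScalars ℝ))
    (fun u a b => by simpa using trace_mul_conjR τ hτ u a b) hΩ h hsupp hQ
  simpa using key

/-- ★ **The space-`R(U₀)` reading for the tracial pairing at every background of units**: `Σ_{x ∈ Ω₀} τ(f(x)·(D^{η*}_{U₀}A)(x)) = 0` for every `f ∈ R(U₀)`
(`InR138`) when `A` satisfies (1.38) in multiplier form. [cite: Balaban1985RegularSpaces, (1.38) p.82, (1.146) p.101; Balaban1985BackgroundPropagators, (3.20)–(3.21) p.394] -/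
theorem sum_trace_mul_covDivB_eq_zero_of_inR138_of_isLandau138 (τ : 𝔸 →ₗ[ℂ] ℂ) (hτ : ∀ a b : 𝔸, τ (a * b) = τ (b * a))
    (hΩ : Ω₀.Finite) {A : Site d → Fin d → 𝔸} (h : IsLandau138 L m η Ω₀ Λs U₀ A) {f : Site d → 𝔸} (hf : InR138 L m η Ω₀ Λs U₀ f) :
    ∑ x ∈ hΩ.toFinset, τ (f x * covDivB η U₀ A x) = 0 := by
  have key := sum_pair_eq_zero_of_inR138_of_isLandau138_units ((LinearMap.mul ℝ 𝔸).compr₂ (τ.restrictScalars ℝ))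
    (fun u a b => by simpa using trace_mul_conjR τ hτ u a b) hΩ h hf
  simpa using key

end Trace

end Literature.MathematicalPhysics.QuantumFieldTheory.Balaban1983to89.B9Eq321LandauOrthogonalZd

end
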